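import Literature.NumberTheory.Automorphic.QuadraticHeckeCharacter
import Literature.NumberTheory.QuadraticForms.QuadraticArtinReciprocity
import HarnessLib

/-!
# `exists_twist_quadraticSign` holds (the quadratic twist `π ⊗ ω_{E/F}`)

Topic `NumberTheory/Automorphic`; namespace `Literature.NumberTheory.Automorphic`; all
declarations fully proved. This file discharges the named fact
`Literature.NumberTheory.Automorphic.exists_twist_quadraticSign` of `TunnellOctahedralGlobal.lean`
(Arthur–Clozel, *Simple algebras, base change, and the advanced theory of the trace formula*,
Ch. 3, proof of Thm. 3.1, p. 172: for a quadratic — there: cyclic of prime degree — extension `E/F`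
and `η` the character of `𝔸_F^×` vanishing exactly on `F^× N(𝔸_E^×)`, "`ζ_v = η(ϖ_v)` … is a root
of unity of order `f_v`", and the twists `π ⊗ η^i` are cuspidal with Hecke matrices `ζ_v^i t_v`;
Thm. 4.2 (d)): for a quadratic extension `E/F` of number fields and a cuspidal automorphic
representation `π` of `GL_n(𝔸_F)` there is a cuspidal `π'` with Satake parameters
`t_{π',v} = ε_{E/F}(v) t_{π,v}` at almost every `v`.

## The proof assembled in the tree

* `QuadraticHeckeCharacter.lean`: `ω = ω_{E/F} = quadraticHeckeChar F θ` (`E = F(√θ)`, `θ ∈ 𝓞 F`),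
  the sign character of the index-two open subgroup `P_F · N_{E/F} J_E ≤ 𝕀_F` (O'Meara's norm
  index theorem 65:21, `OMeara65.normIdeles_index_eq_two_holds`), a Hecke character of finite
  order, unramified at `v ∤ 2θ`, with `ω(ϖ_v) = 1` at the split places and `ω(ϖ_v) = -1` at an
  inert `v ∤ 2θ` **provided** `I_F^v ⊄ P_F N_{E/F} J_E` there (O'Meara 71:17); and the twist
  `π ⊗ (ω ∘ det)` (`CuspidalAutomorphicRepData.twist`, `eventually_hasSatakeParamAt_twist`).
* `QuadraticForms/QuadraticArtinReciprocity.lean`: **O'Meara 71:17 at the tame places**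
  (`QuadraticForms.not_range_localUnits_le_of_not_isSquare`), from Artin reciprocity for the
  quadratic extension `E/F` — the tree's formalization of Artin's proof (Childress Ch. 5,
  `GaloisRepresentations.artinKillsRay_of_finrank_le_relIndex`) fed with the first inequality in
  ideal-theoretic form (`QuadraticForms/QuadraticRayClassNormIndex.lean`, from O'Meara 65:14).

Hence `exists_heckeCharacter_quadraticSign_of_finrank_eq_two` (unconditional form of
`exists_heckeCharacter_quadraticSign_of_inert`) and `exists_twist_quadraticSign_holds`.

## References

* J. Arthur, L. Clozel, *Simple algebras, base change, and the advanced theory of the trace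
  formula*, Ann. of Math. Stud. 120, Princeton (1989), Ch. 3, proof of Thm. 3.1 (p. 172) and
  Thm. 4.2 (d) (p. 173) (PDF pp. 172–173 of the held copy). [ArthurClozelAMS120]
* O. T. O'Meara, *Introduction to quadratic forms*, Grundlehren 117, Springer (1963), §65D
  Prop. 65:21, §71C Prop. 71:17. [Omeara1963]
* N. Childress, *Class Field Theory*, Universitext, Springer 2009, Ch. 5 §2 Thm. 2.1.
  [Childress2009]
-/

noncomputable section

open scoped NumberField
open NumberField IsDedekindDomain Filter Topology

namespace Literature.NumberTheory.Automorphic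

open QuadraticForms GaloisRepresentations

variable {F E : Type} [Field F] [NumberField F] [Field E] [NumberField E] [Algebra F E]

/-- **The quadratic Hecke character `ω_{E/F}` with prescribed values at uniformizers,
unconditionally.** For a quadratic extension `E/F` of number fields there is a Hecke character
`ω` of `F` of finite order such that, at almost every finite place `v` (namely `v ∤ 2θ` unramified
in `E`, for `E = F(√θ)`, `θ ∈ 𝓞 F`), `ω` is unramified and `ω(ϖ_v) = ε_{E/F}(v)` (`+1` at the split,
`-1` at the inert places): `ω = quadraticHeckeChar F θ`, the character of
`𝕀_F / F^× N_{E/F} J_E ≅ ℤ/2`, with `ω(ϖ_v) = -1` at the inert `v` by O'Meara 71:17 at the tame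
places (`QuadraticForms.not_range_localUnits_le_of_not_isSquare`, from Artin reciprocity for `E/F`).
This is Arthur–Clozel's "`ζ_v = η(ϖ_v)` … a root of unity of order `f_v`".
[cite: ArthurClozelAMS120, Ch. 3, proof of Thm. 3.1 (p. 172)] [cite: Omeara1963, §71C Prop. 71:17] -/
theorem exists_heckeCharacter_quadraticSign_of_finrank_eq_two (h2 : Module.finrank F E = 2) :
    ∃ ω : HeckeCharacter F, ω.IsFiniteOrder ∧
      ∀ᶠ v : HeightOneSpectrum (𝓞 F) in Filter.cofinite,
        ω.IsUnramifiedAt v ∧ ω.valueAtUniformizer v = quadraticSign E v := by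
  classical
  haveI : FiniteDimensional F E := Module.finite_of_finrank_eq_succ h2
  haveI : Algebra.IsQuadraticExtension F E := ⟨h2⟩
  haveI : IsGalois F E := inferInstance
  have hprime : (Module.finrank F E).Prime := by rw [h2]; exact Nat.prime_two
  -- `E = F(√θ)`, `θ ∈ 𝓞 F` a non-square
  obtain ⟨θ, α, hθ0, hα, hαF⟩ := exists_integer_sq_eq_of_finrank_eq_two h2
  have hθ : ¬ IsSquare (θ : F) := QuadraticForms.not_isSquare_of_sq_eq hα hαF
  refine ⟨quadraticHeckeChar F θ hθ, isFiniteOrder_quadraticHeckeChar hθ, ?_⟩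
  -- almost every `v`: `v ∤ 2θ` and `v` unramified in `E`
  have hS : ∀ᶠ v : HeightOneSpectrum (𝓞 F) in cofinite,
      θ ∉ v.asIdeal ∧ (2 : 𝓞 F) ∉ v.asIdeal := by
    have h := ((finite_setOf_mem_asIdeal F hθ0).union
      (finite_setOf_mem_asIdeal F (two_ne_zero (α := 𝓞 F)))).compl_mem_cofinite
    filter_upwards [h] with v hv
    simpa only [Set.mem_compl_iff, Set.mem_union, Set.mem_setOf_eq, not_or] using hv
  have hunrE : ∀ᶠ v : HeightOneSpectrum (𝓞 F) in cofinite,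
      Algebra.IsUnramifiedIn (𝓞 E) v.asIdeal := by
    rw [Filter.eventually_cofinite]
    exact finite_setOf_not_isUnramifiedIn F E
  filter_upwards [hS, hunrE] with v hv hvE
  refine ⟨isUnramifiedAt_quadraticHeckeChar hθ hv.2 hv.1, ?_⟩
  have hcard : Nat.card {w : HeightOneSpectrum (𝓞 E) // w.under (𝓞 F) = v} =
      (finitePlacesOver E v).ncard :=
    Nat.card_coe_set_eq (finitePlacesOver E v)
  unfold quadraticSign
  by_cases hsq : IsSquare (algebraMap F (v.adicCompletion F) (θ : F))
  · -- `v` splits: `ω(ϖ_v) = 1 = ε`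
    rw [valueAtUniformizer_quadraticHeckeChar_of_isSquare hθ hsq]
    have h2pl : (finitePlacesOver E v).ncard = 2 :=
      (QuadraticExtension.ncard_finitePlacesOver_eq_two_iff_isSquare hα hαF v).2 hsq
    rcases placesOver_dichotomy_of_prime hprime hvE with ⟨-, hsplit⟩ | ⟨h1, -⟩
    · obtain ⟨w₀, hw₀⟩ := exists_above (E := E) v
      rw [if_pos ⟨w₀, hw₀, hsplit w₀ (HeightOneSpectrum.ext hw₀)⟩]
    · rw [hcard, h2pl] at h1
      exact absurd h1 (by norm_num)
  · -- `v` is inert: `ω(ϖ_v) = -1 = ε` by 71:17 at the tame place `v`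
    have h1pl : (finitePlacesOver E v).ncard = 1 :=
      (QuadraticExtension.ncard_finitePlacesOver_eq_one_iff_not_isSquare hα hαF v).2 hsq
    rw [valueAtUniformizer_quadraticHeckeChar_of_not_le hθ hv.2 hv.1
      (QuadraticForms.not_range_localUnits_le_of_not_isSquare hα hαF hv.2 hv.1 hvE hsq)]
    rcases placesOver_dichotomy_of_prime hprime hvE with ⟨h2', -⟩ | ⟨-, hinert⟩
    · rw [hcard, h1pl, h2] at h2'
      exact absurd h2' (by norm_num)
    · rw [if_neg]
      rintro ⟨w, hw, hfw⟩
      rw [hinert w (HeightOneSpectrum.ext hw), h2] at hfw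
      exact absurd hfw (by norm_num)

/-- **`exists_twist_quadraticSign` holds** (Arthur–Clozel, Ch. 3, proof of Thm. 3.1 and
Thm. 4.2 (d)): for a quadratic extension `E/F` of number fields and a cuspidal `π` on `GL_n(𝔸_F)`,
the cuspidal twist `π' = π ⊗ (ω_{E/F} ∘ det)` (`CuspidalAutomorphicRepData.twist`) has Satake
parameter `ε_{E/F}(v) · t_{π,v}` at almost every place `v`
(`AutomorphicRepData.eventually_hasSatakeParamAt_twist` and
`exists_heckeCharacter_quadraticSign_of_finrank_eq_two`).
[cite: ArthurClozelAMS120, Ch. 3, proof of Thm. 3.1 (p. 172) and Thm. 4.2 (d)] -/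
theorem exists_twist_quadraticSign_holds : exists_twist_quadraticSign := by
  intro n F E _ _ _ _ _ h2 hF π
  obtain ⟨ω, hωfin, hω⟩ := exists_heckeCharacter_quadraticSign_of_finrank_eq_two (E := E) h2
  refine ⟨π.twist ω hωfin, ?_⟩
  filter_upwards [π.1.eventually_hasSatakeParamAt_twist hωfin, hω] with v hv hωv α hα
  rw [← hωv.2]
  exact hv α hα

end Literature.NumberTheory.Automorphic
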